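import Summits.BirchSwinnertonDyer.BirchSwinnertonDyer.Theorems.UniversalToricDescentTwinDecLocusTateCube
import Summits.BirchSwinnertonDyer.Rank1Residual.WAll.TargetAdditiveAtThreeWildLocalTypeTresRamifie
import Literature.NumberTheory.EllipticCurves.MultiplicativeReductionPeuRamifieProofs
import Literature.NumberTheory.EllipticCurves.LocalTorsionMultiplicativeProofs
import Literature.NumberTheory.DiophantineGeometry.GeneralizedFermatTwoPowerCoefficientSerreWeightProofs
import Literature.NumberTheory.GaloisRepresentations.FramedRepBaseChange
import HarnessLib

/-!
# Route `UniversalToricDescent`, cruxes `TwinSplitIMCAtThreeMult` (stmt-BirchSwinnertonDyer-20694, bucket B) and ♭B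
# `TwinWanFrameAtThreeMult` (stmt-BirchSwinnertonDyer-26062), lines `threeframes` v8 / `membertower` v5, research stub
# `stub_wanFrameMultCube`: the CUBE LOCUS IS EMPTY for every 3-multiplicative curve whose mod-3 representation is
# TRÈS RAMIFIÉ at 3 — in particular for every twin of a bucket-B class (Serre 1987 §2.9 Prop. 5, all tree theorems)

Cell `bsd-wall` (run/shared/lean/pub/bsd-wall/), LEAD `bsd-wall-utd-p2` (prover g12, 2026-08-28);
`--supports stmt-BirchSwinnertonDyer-20694 --as helper`; Theses-free.

## Context (numbers, not adjectives)

After width seat w2 g2's p612881 / p614724 the member-tower line for the Wan half at a 3-multiplicative twin `W′` carries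
ONE local research stub, `stub_wanFrameMultCube`: ♭B's consequent on the locus «`W′` split multiplicative at 3 with Tate
parameter `q_{W′} = u³`, `u ∈ ℚ₃`», the EXACT locus where the descent's binder (dec) `W′(ℚ₃)[3] = 0` fails. Bucket B of
the wall census (675 of the 2 023 twin-having onto wild rank-one classes) is, by definition, the set of cell curves `E`
whose mod-3 representation is TRÈS RAMIFIÉ at 3 (ty-1 p538528, `TargetAdditiveAtThreeWildLocalTypeTresRamifie`:
every semistable twin of such a class is multiplicative at 3). This file proves that on très ramifié curves the cube
locus is EMPTY, from tree theorems only: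

* §1 (any odd `p`, `E/ℚ` globally minimal, `Mult E p`): `isPeuRamifie_restrictField_of_mult_of_dvd` — `p ∣ v_p(Δ_min)`
  ⟹ `ρ̄_{E,p}|Γ_{ℚ_v}` peu ramifié (the Literature theorem
  `isPeuRamifie_restrictField_of_hasMultiplicativeReductionAt_of_dvd`, Serre 1987 §2.9 Prop. 5 / (4.1.12), read at the
  place `v ∋ p` of `ℚ` in the `Rank1Residual` currency `Mult` / `padicValInt p Δ_min`); contrapositive
  `not_dvd_padicValInt_of_isTresRamifie` — très ramifié ⟹ `p ∤ v_p(Δ_min)`.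
* §2 (`p = 3`, the twin binders): `twin_forall_not_cube_of_isTresRamifie` — très ramifié ⟹ NO Tate datum of `W′` at 3
  has `q = u³` (w2's `split_and_dvd_of_cube`: a cube forces `3 ∣ v₃(Δ_min)`); `twin_dec_of_isTresRamifie` — hence (dec)
  `W′(ℚ₃)[3] = 0` (w2's `twin_dec_of_forall_not_cube`).
* §3 (the kernel's currency — twins of a CLASS): `forall_not_cube_of_twin_of_isTresRamifie` /
  `dec_of_twin_of_isTresRamifie` — if `E[3]` is très ramifié at 3 and `W′[3] ≅ E[3]` `Γ_ℚ`-equivariantly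
  (`O6.ModPCongruent W′ E 3`), a 3-multiplicative `W′` has no Tate datum with cube `q`, and (dec) holds
  (`O6.ModPCongruentAt.isTresRamifie_restrictField_iff`: très ramifié is an invariant of the `D_v`-module).

NET for the lines: on bucket-B twins `stub_wanFrameMultCube` is VACUOUS — the skeletons' DERIVED
`wanFrameMult_of_stubs_of_isTresRamifie` (threeframes v8 / membertower v5, §5) runs the member tower ONLY; a planner may
re-key ♭B with the single extra binder «`ρ̄_{W′,3}|Γ_{ℚ₃}` très ramifié» (dischargeable by the kernel on bucket B through
§3) and drop the cube locus from the deciding chain. HONEST FRAMING: theorems only (no definition, no named fact, no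
instance, no `sorry`); every input is a PROVED tree theorem; nothing is booked; BSD is proved for no curve; no census
number moves (the cube-locus census ask D7″ becomes moot for bucket B).

References: [Serre1987] §2.4 (ii), §2.8 Prop. 3, §2.9 Prop. 5 (p. 191), (4.1.12); [SerreInventiones1972] §1.11–1.12;
[SilvermanATAEC1994] Thm. V.3.1 (d), Thm. V.5.3; [MazurTateTeitelbaum1986Invent] §II.1 (`v_p(q) = v_p(Δ_min)`).
-/

noncomputable section

open scoped Classical

set_option linter.dupNamespace false
set_option autoImplicit false

namespace Summit.BirchSwinnertonDyer.BirchSwinnertonDyer.Theorems.UniversalToricDescentTwinCubeLocusTresRamifie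

open WeierstrassCurve NumberField IsDedekindDomain Rat.HeightOneSpectrum Field
  Literature.NumberTheory.EllipticCurves Literature.NumberTheory.EllipticCurves.Rank1Residual
  Literature.NumberTheory.GaloisRepresentations Literature.NumberTheory.Automorphic
  Literature.NumberTheory.DiophantineGeometry
  Summit.BirchSwinnertonDyer.Rank1Residual
  Summit.BirchSwinnertonDyer.BirchSwinnertonDyer.Theorems.UniversalToricDescentTwinDecLocus

/-! ### §1 Any odd `p`: multiplicative with `p ∣ v_p(Δ_min)` is peu ramifié; très ramifié forces `p ∤ v_p(Δ_min)` -/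

section OddPrime

variable (W : WeierstrassCurve ℚ) [W.IsElliptic] [W.IsGloballyMinimal] (p : ℕ) [hp : Fact p.Prime]

/-- **`Mult E p` and `p ∣ v_p(Δ_min(E))` ⟹ `ρ̄_{E,p}|Γ_{ℚ_v}` is peu ramifié** at the place `v ∋ p`, for every framing
`ρ̄` of `E[p]` (`p` odd): the Literature theorem `isPeuRamifie_restrictField_of_hasMultiplicativeReductionAt_of_dvd`
(Serre's Tate-curve reading `ℚ_p^nr(ζ_p, q^{1/p})`, `p ∣ v(q)`), with its place-indexed binders discharged for `ℚ`:
`Mult ↔ HasMultiplicativeReductionAt v` (`hasMultiplicativeReductionAtPrime_iff_hasMultiplicativeReductionAt_ringOfIntegers`),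
`ord_v Δ_min = v_p(Δ_min)` (`LocalTorsionMult.ordMinimalDiscriminant_eq_padicValInt`), `𝔪_v = (p)`, `p` a uniformiser;
the coefficient change `𝔽_p → 𝔽_p` of the Literature statement is the identity and is undone by
`FramedRep.baseChange_apply_eq_one_iff`. [cite: Serre1987, §2.9 Prop. 5 and (4.1.12)] [cite: SerreInventiones1972, §1.12] -/
theorem isPeuRamifie_restrictField_of_mult_of_dvd (hp2 : p ≠ 2) (hmult : Mult W p)
    (hdvd : p ∣ padicValInt p W.minimalDiscriminantInt)
    (v : HeightOneSpectrum (𝓞 ℚ)) (hpv : ((p : ℕ) : 𝓞 ℚ) ∈ v.asIdeal)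
    {ρ : ModPGaloisRep ℚ (ZMod p) 2} (hρ : W.IsTorsionGaloisRep p ρ) :
    ModPGaloisRep.IsPeuRamifie (FramedGaloisRep.restrictField (v.adicCompletion ℚ) ρ :
      ModPGaloisRep (v.adicCompletion ℚ) (ZMod p) 2) := by
  -- `v` is THE place above `p`
  have hv : ((primesEquiv (R := 𝓞 ℚ) v : Nat.Primes) : ℕ) = p :=
    (BCDT.natCast_mem_asIdeal_iff_primesEquiv_eq v hp.out).mp hpv
  have hv' : primesEquiv (R := 𝓞 ℚ) v = ⟨p, hp.out⟩ := Subtype.ext hv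
  -- multiplicative reduction at the place `v`
  have hmultv : W.HasMultiplicativeReductionAt v := by
    have h := hasMultiplicativeReductionAtPrime_iff_hasMultiplicativeReductionAt_ringOfIntegers (W := W) v
    have key : ∀ (q : Nat.Primes) (_hq : primesEquiv (R := 𝓞 ℚ) v = q),
        (haveI := Fact.mk q.2; W.HasMultiplicativeReductionAtPrime (q : ℕ)) →
          W.HasMultiplicativeReductionAt v := by
      rintro q rfl hq; exact h.mp hq
    exact key ⟨p, hp.out⟩ hv' hmult
  -- `p ∣ ord_v Δ_min`
  have hpord : p ∣ W.ordMinimalDiscriminant v := by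
    rw [LocalTorsionMult.ordMinimalDiscriminant_eq_padicValInt W v hv]; exact hdvd
  -- `𝔪_v = (p)` and `p` is a uniformiser of `ℚ_v`
  have hgen := natCast_dvd_of_mem_maximalIdeal_adicCompletionIntegers (v := v) hpv
  have hirr := irreducible_natCast_valuativeInteger_adicCompletion_of_natCast_mem (p := p) hpv
  -- Serre §2.9 Prop. 5 on `ρ̄ ⊗_{id} 𝔽_p`
  have hbc := W.isPeuRamifie_restrictField_of_hasMultiplicativeReductionAt_of_dvd p hp2 v hpv hmultv hpord
    hgen hirr hρ (RingHom.id (ZMod p)) continuous_id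
  intro u hu σ hσ
  have h1 := hbc u hu σ hσ
  rw [FramedGaloisRep.restrictField_apply] at h1 ⊢
  exact (FramedRep.baseChange_apply_eq_one_iff (RingHom.id (ZMod p)) continuous_id (fun _ _ h ↦ h) ρ _).mp h1

/-- **Très ramifié ⟹ `p ∤ v_p(Δ_min)` at a multiplicative odd `p`** (contrapositive of
`isPeuRamifie_restrictField_of_mult_of_dvd`; très ramifié is the negation of peu ramifié,
`ModPGaloisRep.isTresRamifie_iff_not_isPeuRamifie`). [cite: Serre1987, §2.4 (ii) and §2.9 Prop. 5] -/
theorem not_dvd_padicValInt_of_isTresRamifie (hp2 : p ≠ 2) (hmult : Mult W p)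
    (v : HeightOneSpectrum (𝓞 ℚ)) (hpv : ((p : ℕ) : 𝓞 ℚ) ∈ v.asIdeal)
    {ρ : ModPGaloisRep ℚ (ZMod p) 2} (hρ : W.IsTorsionGaloisRep p ρ)
    (htres : ModPGaloisRep.IsTresRamifie (FramedGaloisRep.restrictField (v.adicCompletion ℚ) ρ :
      ModPGaloisRep (v.adicCompletion ℚ) (ZMod p) 2)) :
    ¬ p ∣ padicValInt p W.minimalDiscriminantInt := fun hdvd ↦
  (ModPGaloisRep.isTresRamifie_iff_not_isPeuRamifie _).mp htres
    (isPeuRamifie_restrictField_of_mult_of_dvd W p hp2 hmult hdvd v hpv hρ)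

end OddPrime

/-! ### §2 `p = 3`: no Tate datum with cube parameter, and (dec), for a très ramifié 3-multiplicative curve -/

section Three

variable (W' : WeierstrassCurve ℚ) [W'.IsElliptic] [W'.IsGloballyMinimal]

/-- The place of `ℚ` above `3`. [folklore] -/
theorem exists_place_three : ∃ v : HeightOneSpectrum (𝓞 ℚ), ((3 : ℕ) : 𝓞 ℚ) ∈ v.asIdeal :=
  ⟨(primesEquiv (R := 𝓞 ℚ)).symm ⟨3, Nat.prime_three⟩,
    (BCDT.natCast_mem_asIdeal_iff_primesEquiv_eq _ Nat.prime_three).mpr (by rw [Equiv.apply_symm_apply])⟩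

/-- **The cube locus is EMPTY on très ramifié curves**: `Mult W′ 3` and `ρ̄_{W′,3}|Γ_{ℚ_v}` très ramifié at the place
`v ∋ 3` ⟹ no Tate parameter datum `D` of `W′` at 3 has `D.q = u³`, `u ∈ ℚ₃` — a cube forces `3 ∣ v₃(Δ_min(W′))`
(w2's `split_and_dvd_of_cube`, `v₃(q) = v₃(Δ_min)`), against §1.
[cite: Serre1987, §2.9 Prop. 5] [cite: MazurTateTeitelbaum1986Invent, §II.1] [cite: SilvermanATAEC1994, Thm. V.3.1 (d)] -/
theorem twin_forall_not_cube_of_isTresRamifie (hmult : Mult W' 3)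
    {ρ : ModPGaloisRep ℚ (ZMod 3) 2} (hρ : W'.IsTorsionGaloisRep 3 ρ)
    (htres : ∀ v : HeightOneSpectrum (𝓞 ℚ), ((3 : ℕ) : 𝓞 ℚ) ∈ v.asIdeal →
      ModPGaloisRep.IsTresRamifie (FramedGaloisRep.restrictField (v.adicCompletion ℚ) ρ :
        ModPGaloisRep (v.adicCompletion ℚ) (ZMod 3) 2)) :
    ∀ D : TateParameterData W' 3, ¬ ∃ u : ℚ_[3], u ^ 3 = D.q := by
  intro D hq
  obtain ⟨-, hdvd⟩ := split_and_dvd_of_cube W' D hq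
  obtain ⟨v, hv⟩ := exists_place_three
  exact not_dvd_padicValInt_of_isTresRamifie W' 3 (by norm_num) hmult v hv hρ (htres v hv) hdvd

/-- **(dec) `W′(ℚ₃)[3] = 0` for a très ramifié 3-multiplicative curve** (§2's emptiness of the cube locus fed to
w2's `twin_dec_of_forall_not_cube`): the descent kernel's local binder holds with NO residual locus.
[cite: Serre1987, §2.9 Prop. 5] [cite: SilvermanATAEC1994, Thm. V.3.1 (d) and Thm. V.5.3] -/
theorem twin_dec_of_isTresRamifie (hmult : Mult W' 3)
    {ρ : ModPGaloisRep ℚ (ZMod 3) 2} (hρ : W'.IsTorsionGaloisRep 3 ρ)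
    (htres : ∀ v : HeightOneSpectrum (𝓞 ℚ), ((3 : ℕ) : 𝓞 ℚ) ∈ v.asIdeal →
      ModPGaloisRep.IsTresRamifie (FramedGaloisRep.restrictField (v.adicCompletion ℚ) ρ :
        ModPGaloisRep (v.adicCompletion ℚ) (ZMod 3) 2)) :
    ∀ Q : (W'.baseChange ℚ_[3]).toAffine.Point, 3 • Q = 0 → Q = 0 :=
  twin_dec_of_forall_not_cube W' hmult (twin_forall_not_cube_of_isTresRamifie W' hmult hρ htres)

end Three

/-! ### §3 The kernel's currency: twins of a très ramifié CLASS (bucket B) -/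

section Class

variable {W : WeierstrassCurve ℚ} [W.IsElliptic]
  (W' : WeierstrassCurve ℚ) [W'.IsElliptic] [W'.IsGloballyMinimal]

omit [W.IsElliptic] in
/-- **No cube Tate parameter for a 3-multiplicative twin of a très ramifié class**: `E[3]` très ramifié at the
place above 3 (for a framing `ρ̄` of `E[3]`), `W′[3] ≅ E[3]` `Γ_ℚ`-equivariantly (`O6.ModPCongruent W′ E 3`) and
`Mult W′ 3` ⟹ every Tate datum of `W′` at 3 has a non-cube `q`. Très ramifié passes to `W′` place by place
(`O6.ModPCongruentAt.isTresRamifie_restrictField_iff`), then §2. This is the shape the UTD kernel can discharge on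
bucket B. [cite: Serre1987, §2.8 Prop. 3 and §2.9 Prop. 5] [cite: SerreInventiones1972, §1.11–1.12] -/
theorem forall_not_cube_of_twin_of_isTresRamifie {ρ : ModPGaloisRep ℚ (ZMod 3) 2}
    (hρ : W.IsTorsionGaloisRep 3 ρ)
    (htres : ∀ v : HeightOneSpectrum (𝓞 ℚ), ((3 : ℕ) : 𝓞 ℚ) ∈ v.asIdeal →
      ModPGaloisRep.IsTresRamifie (FramedGaloisRep.restrictField (v.adicCompletion ℚ) ρ :
        ModPGaloisRep (v.adicCompletion ℚ) (ZMod 3) 2))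
    (hc : O6.ModPCongruent W' W 3) (hmult : Mult W' 3) :
    ∀ D : TateParameterData W' 3, ¬ ∃ u : ℚ_[3], u ^ 3 = D.q := by
  haveI : NeZero ((3 : ℕ) : ℚ) := ⟨by norm_num⟩
  obtain ⟨ρ', hρ'⟩ := W'.exists_isTorsionGaloisRep 3
  refine twin_forall_not_cube_of_isTresRamifie W' hmult hρ' fun v hv ↦ ?_
  exact ((hc.modPCongruentAt v).isTresRamifie_restrictField_iff hρ hρ').mpr (htres v hv)

omit [W.IsElliptic] in
/-- **(dec) for a 3-multiplicative twin of a très ramifié class** — the descent kernel's binder `hiv` on ALL of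
bucket B, no cube-locus residue. [cite: Serre1987, §2.9 Prop. 5] [cite: SilvermanATAEC1994, Thm. V.5.3] -/
theorem dec_of_twin_of_isTresRamifie {ρ : ModPGaloisRep ℚ (ZMod 3) 2}
    (hρ : W.IsTorsionGaloisRep 3 ρ)
    (htres : ∀ v : HeightOneSpectrum (𝓞 ℚ), ((3 : ℕ) : 𝓞 ℚ) ∈ v.asIdeal →
      ModPGaloisRep.IsTresRamifie (FramedGaloisRep.restrictField (v.adicCompletion ℚ) ρ :
        ModPGaloisRep (v.adicCompletion ℚ) (ZMod 3) 2))
    (hc : O6.ModPCongruent W' W 3) (hmult : Mult W' 3) :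
    ∀ Q : (W'.baseChange ℚ_[3]).toAffine.Point, 3 • Q = 0 → Q = 0 :=
  twin_dec_of_forall_not_cube W' hmult (forall_not_cube_of_twin_of_isTresRamifie W' hρ htres hc hmult)

end Class

/-! ### §4 (appended, lead g12) The same in the `Δ_min` currency of the descent's binder, for the kernel -/

section ClassDelta

variable {W : WeierstrassCurve ℚ}
  (W' : WeierstrassCurve ℚ) [W'.IsElliptic] [W'.IsGloballyMinimal]

/-- **`3 ∤ v₃(Δ_min(W′))` for a 3-multiplicative twin of a très ramifié class** — the form of §3 that a re-keyed ♭B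
«… → `¬ 3 ∣ v₃(Δ_min(W′))` → …» asks the kernel to discharge in its multiplicative branch: `E[3]` très ramifié at the
place above 3, `W′[3] ≅ E[3]` `Γ_ℚ`-equivariantly (`O6.ModPCongruent W′ E 3`), `Mult W′ 3` ⟹ `3 ∤ v₃(Δ_min(W′))`
(très ramifié passes to `W′` by `O6.ModPCongruentAt.isTresRamifie_restrictField_iff`, then §1's
`not_dvd_padicValInt_of_isTresRamifie`). [cite: Serre1987, §2.8 Prop. 3 and §2.9 Prop. 5] [cite: SerreInventiones1972, §1.11–1.12] -/
theorem not_dvd_padicValInt_of_twin_of_isTresRamifie {ρ : ModPGaloisRep ℚ (ZMod 3) 2}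
    (hρ : W.IsTorsionGaloisRep 3 ρ)
    (htres : ∀ v : HeightOneSpectrum (𝓞 ℚ), ((3 : ℕ) : 𝓞 ℚ) ∈ v.asIdeal →
      ModPGaloisRep.IsTresRamifie (FramedGaloisRep.restrictField (v.adicCompletion ℚ) ρ :
        ModPGaloisRep (v.adicCompletion ℚ) (ZMod 3) 2))
    (hc : O6.ModPCongruent W' W 3) (hmult : Mult W' 3) :
    ¬ 3 ∣ padicValInt 3 W'.minimalDiscriminantInt := by
  haveI : NeZero ((3 : ℕ) : ℚ) := ⟨by norm_num⟩
  obtain ⟨ρ', hρ'⟩ := W'.exists_isTorsionGaloisRep 3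
  obtain ⟨v, hv⟩ := exists_place_three
  exact not_dvd_padicValInt_of_isTresRamifie W' 3 (by norm_num) hmult v hv hρ'
    (((hc.modPCongruentAt v).isTresRamifie_restrictField_iff hρ hρ').mpr (htres v hv))

/-- **The descent binder's sufficient condition «non-split ∨ `3 ∤ v₃(Δ_min)`» holds for every 3-multiplicative twin of
a très ramifié class** (right disjunct, from `not_dvd_padicValInt_of_twin_of_isTresRamifie`) — so w2's
`forall_not_exists_pow_of_nonsplit_or_not_dvd` and `twin_dec_of_forall_not_cube` apply with no residual locus.
[cite: Serre1987, §2.9 Prop. 5] [cite: SilvermanATAEC1994, Thm. V.5.3] -/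
theorem nonsplit_or_not_dvd_of_twin_of_isTresRamifie {ρ : ModPGaloisRep ℚ (ZMod 3) 2}
    (hρ : W.IsTorsionGaloisRep 3 ρ)
    (htres : ∀ v : HeightOneSpectrum (𝓞 ℚ), ((3 : ℕ) : 𝓞 ℚ) ∈ v.asIdeal →
      ModPGaloisRep.IsTresRamifie (FramedGaloisRep.restrictField (v.adicCompletion ℚ) ρ :
        ModPGaloisRep (v.adicCompletion ℚ) (ZMod 3) 2))
    (hc : O6.ModPCongruent W' W 3) (hmult : Mult W' 3) :
    ¬ W'.HasSplitMultiplicativeReductionAtPrime 3 ∨ ¬ 3 ∣ padicValInt 3 W'.minimalDiscriminantInt :=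
  Or.inr (not_dvd_padicValInt_of_twin_of_isTresRamifie W' hρ htres hc hmult)

end ClassDelta

end Summit.BirchSwinnertonDyer.BirchSwinnertonDyer.Theorems.UniversalToricDescentTwinCubeLocusTresRamifie

end
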